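import Literature.IUT.LogThetaLattice.MultiradialityRemarksRmk212Proofs
import Literature.AnabelianGeometry.AbsoluteAnabelian.AbsTopIThm26ChiTwistedModelInstances
import Literature.AnabelianGeometry.AbsoluteAnabelian.MonoidKummerModel
import Literature.AnabelianGeometry.EtaleTheta.SettingModelIndependence
import HarnessLib

/-!
# [IUTchIII] Rmk 2.1.2 (ii) `N_{Π̂}(Π†)/Π† ≅ Ẑ/ℤ` AT THE CELL'S OWN TEMPERED MODELS — the "partially tempered"
# `Π† := Π̂ ×_Ẑ ℤ` of print IS the semi-synthetic `Π^tp` of the [EtTh] §1 models (PROOF-ONLY; FACT-LIST F-1785,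
# L-F register row LF6-52; abc-iut cell, layer L6, seat abc-iut-L6-t4 gen 17 = typer of record of the schema)

S. Mochizuki, *Inter-universal Teichmüller theory III*, kurims manuscript (May 2020), §2, Remark 2.1.2 (ii),
p. 64 l. 22 – p. 65 l. 5 [claim: Mochizuki2012, status: disputed] (D-0012 claim key; nothing of the series is
asserted here).  PRINT (p. 64 l. 23–44): "Write `Π := Π_v`; `Π̂` for the profinite completion of `Π`. Thus,
we have natural surjections `Π ↠ l·ℤ (⊆ ℤ)`, `Π̂ ↠ l·Ẑ (⊆ Ẑ)`. Write `Π† := Π̂ ×_Ẑ ℤ ⊆ Π̂`."  … "Is it possible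
to simply use the 'partially tempered fundamental group' `Π†` instead of the 'full' tempered fundamental group
`Π` in the theory of the present series of papers?  The answer to this question is 'no'. One way to see this is
to consider the [easily verified] natural isomorphism `N_{Π̂}(Π†)/Π† ⥲ Ẑ/ℤ` involving the normalizer `N_{Π̂}(Π†)`
of `Π†` in `Π̂`. One consequence of this isomorphism is that — unlike the tempered fundamental group `Π` [cf.,
e.g., [SemiAnbd], Theorems 6.6, 6.8] — the topological group `Π†` fails to satisfy various fundamental absolute
anabelian properties"; (p. 65 l. 2–5) "such `Ẑ`-translation indeterminacies are avoided precisely by applying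
the 'complements on tempered coverings' developed in [IUTchI], §2 — i.e., in a word, as a consequence of the
'highly anabelian nature' of the [full!] tempered fundamental group `Π`."

TYPED SCHEMA (abc-iut-L6-t4, `MultiradialityRemarks.lean` p404906): `Rmk212ii_normalizerQuotient Π† ZhatModZ :=
Nonempty (N_{Π̂}(Π†)/Π† ≃* ZhatModZ)`; its ∀-closure over FREE `(Π†, ZhatModZ)` is FALSE
(`not_forall_Rmk212ii_normalizerQuotient`, p417614); print's own construction is PROVED for every surjection
`f : Π̂ ↠ A` onto an abelian group and every `Z ≤ A` (`rmk212ii_normalizerQuotient_of_surjective`, p418103: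
`Π† := f⁻¹(Z)` is normal, `N_{Π̂}(Π†)/Π† ≃* A/Z`).

THIS FILE instantiates F-1785 at the cell's GENUINE MODELS — where print's `Π†` is not an auxiliary object but
LITERALLY the group the cell works with:

* **(A) the geometric [EtTh] §1 finer model** (abc-iut-L2-t1 `SettingModel2Curve.lean`): `Π̂ := F̂₂`
  (`F₂hatT`), the completed `a`-exponent `ê : F̂₂ ↠ Ẑ` (`eHat`, surjective: abc-iut's `eHat_surjective`),
  `ι : ℤ ↪ Ẑ` (`iotaZ`) and `Γ := F̂₂ ×_Ẑ ℤ` (`Gfp`, with `pr₁ = gfpFst : Γ ↪ F̂₂` a profinite completion):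
  `range_gfpFst_eq_comap_eHat` — `pr₁(Γ) = ê⁻¹(ι(ℤ))`, i.e. the cell's tempered geometric group IS print's
  `Π† = Π̂ ×_Ẑ ℤ ⊆ Π̂`; `normalizer_range_gfpFst_eq_top` — `N_{F̂₂}(Π†) = F̂₂`;
  **`rmk212ii_normalizerQuotient_gfpFst : Rmk212ii_normalizerQuotient pr₁(Γ) (Ẑ ⧸ ι(ℤ))`** — F-1785 with the
  target LITERALLY `Ẑ/ℤ`; `range_iotaZ_ne_top` (`ι(ℤ) ≠ Ẑ`, from `not_countable_zHat`) and
  `range_gfpFst_ne_top` / `range_gfpFst_ne_normalizer` — `Π† ⊊ N_{Π̂}(Π†)`: `Π†` is NOT normally terminal.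
* **(B) the χ-twisted arithmetic [EtTh] §1 model `curveχ p`** (stage 1; abc-iut-w5-d249 / L2-t1
  `SettingModelChiSemidirect.lean`: `Π^tp := Γ ⋊_χ G_{ℚ_p} → Π̂ := F̂₂ ⋊_χ G_{ℚ_p}`, `toHatχ = pr₁ ⋊ id`; the stage-2
  Tate model of record `curveχq p i j` is abc-iut-L6-d2's `not_piTempNormallyTerminal_curveχq`, p496104, landed five
  minutes earlier — same mechanism, different carrier): `mem_range_toHatχ_iff` —
  `g ∈ Π^tp ⇔ ê(g.left) ∈ ι(ℤ)` (the `a`-exponent is `θ_χ`-invariant, `eHat_twist`, so `g ↦ ê(g.left)` is a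
  character of the semidirect product and `Π^tp` its `Ẑ`-PREIMAGE of `ℤ`); `normalizer_range_toHatχ_eq_top`;
  **`rmk212ii_normalizerQuotient_curveχ : Rmk212ii_normalizerQuotient (range (curveχ p).toHat) (Ẑ ⧸ ι(ℤ))`**;
  **`not_piTempNormallyTerminal_curveχ : ¬ (curveχ p).PiTempNormallyTerminal`** — the typed [SemiAnbd]
  Lem. 6.1 (iii) (`TemperedCurve.PiTempNormallyTerminal`, FACT-LIST F-1678) FAILS at `curveχ p`.

So the abc-iut-L6-lead census sentence (§F v1.19du (A4)) "ROOT CAUSE = MODEL ARTEFACT: the semi-synthetic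
`Π^tp_X = ê⁻¹(ℤ) ⋊ G` is normal in its completion `F̂₂ ⋊ G`, so the typed [SemiAnbd] Lem 6.1 (iii) fails for it"
is a kernel theorem (here at stage 1; at the stage-2 model of record in p496104), and it is print's OWN Remark
2.1.2 (ii): a `Ẑ`-preimage ("partially tempered")
group cannot replace the tempered one.  The abelian-normality instance on `Ẑ` used to FORM `Ẑ ⧸ ι(ℤ)` is the
landed `Literature.AnabelianGeometry.SemiGraphs.ZHat.instCommGroup` (`MonoidKummerModel.lean`); no definition,
instance, notation or named fact is declared here.

HONEST FRAMING: statements about OUR semi-synthetic models and OUR typed schema; the "no" of Rmk. 2.1.2 (ii)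
is quoted, not evaluated; instance-at-our-model ≠ print's ∀-closure (refuted); no side taken on [IUTchIII]
Cor. 3.12; typed ≠ proved; nothing here asserts abc proved or refuted.
-/

noncomputable section

namespace Literature.IUT.LogThetaLattice.MultiradialityRemarks

open Literature.AnabelianGeometry.SemiGraphs Literature.AnabelianGeometry.EtaleTheta.SettingModel
open Literature.AnabelianGeometry.AbsoluteAnabelian (eHat_surjective)
open Function

/-! ### `ι(ℤ) ⊊ Ẑ` -/

/-- `ι : ℤ → Ẑ` is not surjective (`Ẑ` is uncountable, abc-iut's `not_countable_zHat`; `ℤ` is countable).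
([IUTchIII] Rmk 2.1.2 (ii) p.64: "`Ẑ/ℤ`" is a nontrivial quotient.) [claim: Mochizuki2012, status: disputed] -/
theorem iotaZ_not_surjective : ¬ Surjective (iotaZ : Multiplicative ℤ → ZH) := fun h =>
  not_countable_zHat (h.countable)

/-- Hence `ι(ℤ) ≠ Ẑ` as a subgroup. ([IUTchIII] Rmk 2.1.2 (ii) p.64) [claim: Mochizuki2012, status: disputed] -/
theorem range_iotaZ_ne_top : (iotaZ : Multiplicative ℤ →* ZH).range ≠ ⊤ := fun h =>
  iotaZ_not_surjective (MonoidHom.range_eq_top.mp h)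

/-- `Ẑ/ℤ` is nontrivial. ([IUTchIII] Rmk 2.1.2 (ii) p.64) [claim: Mochizuki2012, status: disputed] -/
theorem nontrivial_zHat_quotient_range_iotaZ : Nontrivial (ZH ⧸ (iotaZ : Multiplicative ℤ →* ZH).range) :=
  QuotientGroup.nontrivial_iff.mpr range_iotaZ_ne_top

/-! ### (A) The geometric model: `pr₁(Γ) = ê⁻¹(ι(ℤ)) = Π† ⊆ Π̂ = F̂₂` -/

/-- **The cell's tempered geometric group IS print's `Π† := Π̂ ×_Ẑ ℤ ⊆ Π̂`**: the image of
`pr₁ : Γ = F̂₂ ×_Ẑ ℤ → F̂₂` is the preimage `ê⁻¹(ι(ℤ))` of `ℤ ⊆ Ẑ` under the completed `a`-exponent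
`ê : F̂₂ ↠ Ẑ`. ([IUTchIII] Rmk 2.1.2 (ii) p.64 "`Π† := Π̂ ×_Ẑ ℤ ⊆ Π̂`") [claim: Mochizuki2012, status: disputed] -/
theorem range_gfpFst_eq_comap_eHat :
    (gfpFst : Gfp →ₜ* F₂hatT).toMonoidHom.range =
      ((iotaZ : Multiplicative ℤ →* ZH).range).comap (eHat : F₂hatT →ₜ* ZH).toMonoidHom := by
  ext x
  constructor
  · rintro ⟨q, rfl⟩
    exact ⟨(q : F₂hatT × Multiplicative ℤ).2, ((mem_Gfp _).mp q.2).symm⟩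
  · rintro ⟨n, hn⟩
    exact ⟨⟨(x, n), (mem_Gfp _).mpr hn.symm⟩, rfl⟩

/-- `Π† = pr₁(Γ)` is NORMAL in `Π̂ = F̂₂` (a preimage of a subgroup of the abelian `Ẑ`).
([IUTchIII] Rmk 2.1.2 (ii) p.64) [claim: Mochizuki2012, status: disputed] -/
theorem normal_range_gfpFst : ((gfpFst : Gfp →ₜ* F₂hatT).toMonoidHom.range).Normal := by
  rw [range_gfpFst_eq_comap_eHat]
  infer_instance

/-- Hence `N_{Π̂}(Π†) = Π̂` for `Π† = pr₁(Γ) ⊆ F̂₂`. ([IUTchIII] Rmk 2.1.2 (ii) p.64)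
[claim: Mochizuki2012, status: disputed] -/
theorem normalizer_range_gfpFst_eq_top :
    Subgroup.normalizer (((gfpFst : Gfp →ₜ* F₂hatT).toMonoidHom.range : Subgroup F₂hatT) : Set F₂hatT) = ⊤ :=
  haveI := normal_range_gfpFst
  Subgroup.normalizer_eq_top _

/-- **F-1785 / IUTchIII:Rmk2.1.2(ii) AT THE GEOMETRIC [EtTh] §1 MODEL, target LITERALLY `Ẑ/ℤ`:**
`N_{F̂₂}(pr₁(Γ))/pr₁(Γ) ≃* Ẑ/ι(ℤ)` — abc-iut-L6-t4's schema `Rmk212ii_normalizerQuotient` holds for the cell's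
`Π† = pr₁(F̂₂ ×_Ẑ ℤ)`, by print's own verification (`rmk212ii_normalizerQuotient_of_surjective` at the surjection
`ê : F̂₂ ↠ Ẑ` and `Z := ι(ℤ)`). ([IUTchIII] Rmk 2.1.2 (ii) p.64 "the [easily verified] natural isomorphism
`N_{Π̂}(Π†)/Π† ⥲ Ẑ/ℤ`") [claim: Mochizuki2012, status: disputed] -/
theorem rmk212ii_normalizerQuotient_gfpFst :
    Rmk212ii_normalizerQuotient (gfpFst : Gfp →ₜ* F₂hatT).toMonoidHom.range
      (ZH ⧸ (iotaZ : Multiplicative ℤ →* ZH).range) := by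
  rw [range_gfpFst_eq_comap_eHat]
  exact rmk212ii_normalizerQuotient_of_surjective _ eHat_surjective _

/-- `Π† = pr₁(Γ) ≠ Π̂`: some element of `F̂₂` has `a`-exponent outside `ι(ℤ)` (`ê` surjective, `ι(ℤ) ≠ Ẑ`).
([IUTchIII] Rmk 2.1.2 (ii) p.64) [claim: Mochizuki2012, status: disputed] -/
theorem range_gfpFst_ne_top : (gfpFst : Gfp →ₜ* F₂hatT).toMonoidHom.range ≠ ⊤ := by
  intro h
  apply range_iotaZ_ne_top
  rw [eq_top_iff]
  intro t _
  obtain ⟨x, rfl⟩ := eHat_surjective t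
  have hx : x ∈ (gfpFst : Gfp →ₜ* F₂hatT).toMonoidHom.range := h ▸ Subgroup.mem_top x
  rw [range_gfpFst_eq_comap_eHat] at hx
  exact hx

/-- **`Π†` is NOT normally terminal in `Π̂`**: `pr₁(Γ) ⊊ N_{F̂₂}(pr₁(Γ)) = F̂₂` — print: "`Π†` fails to satisfy
various fundamental absolute anabelian properties". ([IUTchIII] Rmk 2.1.2 (ii) p.65 l.1–5)
[claim: Mochizuki2012, status: disputed] -/
theorem range_gfpFst_ne_normalizer :
    Subgroup.normalizer (((gfpFst : Gfp →ₜ* F₂hatT).toMonoidHom.range : Subgroup F₂hatT) : Set F₂hatT) ≠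
      (gfpFst : Gfp →ₜ* F₂hatT).toMonoidHom.range := by
  rw [normalizer_range_gfpFst_eq_top]
  exact fun h => range_gfpFst_ne_top h.symm

/-! ### (B) The χ-twisted arithmetic model `curveχ p` (stage 1): `Π^tp = Γ ⋊_χ G_{ℚ_p} ⊆ Π̂ = F̂₂ ⋊_χ G_{ℚ_p}` -/

section Arith

variable (p : ℕ) [Fact p.Prime]

/-- In `Π̂ = F̂₂ ⋊_χ G_{ℚ_p}` the image of `Π^tp = Γ ⋊_χ G_{ℚ_p}` under `pr₁ ⋊ id` is cut out by the
`a`-exponent: `g ∈ Π^tp ⇔ ê(g.left) ∈ ι(ℤ)` — the model's `Π^tp` is a `Ẑ`-preimage of `ℤ`, i.e. a "partially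
tempered" group in the sense of print. ([IUTchIII] Rmk 2.1.2 (ii) p.64) [claim: Mochizuki2012, status: disputed] -/
theorem mem_range_toHatχ_iff (g : PiHtχ p) :
    g ∈ (toHatχ p).toMonoidHom.range ↔ eHat g.left ∈ (iotaZ : Multiplicative ℤ →* ZH).range := by
  constructor
  · rintro ⟨h, rfl⟩
    change eHat (gfpFst h.left) ∈ _
    exact ⟨(h.left : F₂hatT × Multiplicative ℤ).2, ((mem_Gfp _).mp h.left.2).symm⟩
  · rintro ⟨n, hn⟩
    refine ⟨SemidirectProduct.inl ⟨(g.left, n), (mem_Gfp _).mpr hn.symm⟩ * SemidirectProduct.inr g.right, ?_⟩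
    change toHatχ p _ = g
    rw [map_mul]
    ext
    · simp only [SemidirectProduct.mul_left, toHatχ_left, toHatχ_right, SemidirectProduct.left_inl,
        SemidirectProduct.left_inr, SemidirectProduct.right_inl, map_one, mul_one]
      rfl
    · simp only [SemidirectProduct.mul_right, toHatχ_right, SemidirectProduct.right_inl,
        SemidirectProduct.right_inr, one_mul]

/-- The image of `Π^tp` in `Π̂ = F̂₂ ⋊_χ G_{ℚ_p}` is the preimage of `ι(ℤ) ≤ Ẑ` under a SURJECTIVE character
`Π̂ ↠ Ẑ` (namely `g ↦ ê(g.left)`, a homomorphism because `ê ∘ θ_{χ(σ)} = ê`, `eHat_twist`).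
([IUTchIII] Rmk 2.1.2 (ii) p.64) [claim: Mochizuki2012, status: disputed] -/
theorem exists_range_toHatχ_eq_comap :
    ∃ f : PiHtχ p →* ZH, Surjective f ∧
      (toHatχ p).toMonoidHom.range = ((iotaZ : Multiplicative ℤ →* ZH).range).comap f := by
  let f : PiHtχ p →* ZH :=
    { toFun := fun g => eHat g.left
      map_one' := by simp only [SemidirectProduct.one_left, map_one]
      map_mul' := fun g h => by
        simp only [SemidirectProduct.mul_left, map_mul, actHatχ_apply, eHat_twist] }
  refine ⟨f, fun t => ?_, ?_⟩
  · obtain ⟨x, rfl⟩ := eHat_surjective t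
    exact ⟨SemidirectProduct.inl x, by simp [f]⟩
  · ext g
    rw [mem_range_toHatχ_iff, Subgroup.mem_comap]
    rfl

/-- `Π^tp ⊴ Π̂` at `curveχ p`: the image of `Π^tp = Γ ⋊_χ G_{ℚ_p}` is NORMAL in `F̂₂ ⋊_χ G_{ℚ_p}`.
([IUTchIII] Rmk 2.1.2 (ii) p.64) [claim: Mochizuki2012, status: disputed] -/
theorem normal_range_toHatχ : ((toHatχ p).toMonoidHom.range).Normal := by
  obtain ⟨f, -, hf⟩ := exists_range_toHatχ_eq_comap p
  rw [hf]
  infer_instance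

/-- Hence `N_{Π̂}(Π^tp) = Π̂` at `curveχ p`. ([IUTchIII] Rmk 2.1.2 (ii) p.64)
[claim: Mochizuki2012, status: disputed] -/
theorem normalizer_range_toHatχ_eq_top :
    Subgroup.normalizer (((toHatχ p).toMonoidHom.range : Subgroup (PiHtχ p)) : Set (PiHtχ p)) = ⊤ :=
  haveI := normal_range_toHatχ p
  Subgroup.normalizer_eq_top _

/-- **F-1785 / IUTchIII:Rmk2.1.2(ii) AT THE χ-TWISTED ARITHMETIC MODEL `curveχ p`** (stage 1):
`N_{Π̂}(Π^tp)/Π^tp ≃* Ẑ/ι(ℤ)` for `Π^tp = Γ ⋊_χ G_{ℚ_p} ↪ Π̂ = F̂₂ ⋊_χ G_{ℚ_p}` — the schema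
`Rmk212ii_normalizerQuotient (range (curveχ p).toHat) (Ẑ ⧸ ι(ℤ))`. ([IUTchIII] Rmk 2.1.2 (ii) p.64 "the natural
isomorphism `N_{Π̂}(Π†)/Π† ⥲ Ẑ/ℤ`") [claim: Mochizuki2012, status: disputed] -/
theorem rmk212ii_normalizerQuotient_curveχ :
    Rmk212ii_normalizerQuotient ((curveχ p).toHat.toMonoidHom.range)
      (ZH ⧸ (iotaZ : Multiplicative ℤ →* ZH).range) := by
  change Rmk212ii_normalizerQuotient ((toHatχ p).toMonoidHom.range) _
  obtain ⟨f, hfs, hf⟩ := exists_range_toHatχ_eq_comap p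
  rw [hf]
  exact rmk212ii_normalizerQuotient_of_surjective f hfs _

/-- `Π^tp ≠ Π̂` at `curveχ p` (an element `inl x` with `ê(x) ∉ ι(ℤ)`).
([IUTchIII] Rmk 2.1.2 (ii) p.64) [claim: Mochizuki2012, status: disputed] -/
theorem range_toHatχ_ne_top : (toHatχ p).toMonoidHom.range ≠ ⊤ := by
  obtain ⟨f, hfs, hf⟩ := exists_range_toHatχ_eq_comap p
  rw [hf]
  intro h
  apply range_iotaZ_ne_top
  rw [eq_top_iff]
  intro t _
  obtain ⟨g, rfl⟩ := hfs t
  have hg : g ∈ ((iotaZ : Multiplicative ℤ →* ZH).range).comap f := h ▸ Subgroup.mem_top g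
  exact hg

/-- **The typed [SemiAnbd] Lem. 6.1 (iii) FAILS at the χ-twisted model `curveχ p`**:
`¬ (curveχ p).PiTempNormallyTerminal`
— `N_{Π̂}(Π^tp) = Π̂ ⊋ Π^tp` (FACT-LIST F-1678 `TemperedCurve.PiTempNormallyTerminal` at `curveχ p`).  This is the
abc-iut-L6-lead census sentence "the semi-synthetic `Π^tp = ê⁻¹(ℤ) ⋊ G` is normal in its completion" as a kernel
theorem, and it is what [IUTchIII] Rmk. 2.1.2 (ii) says of ANY "partially tempered" `Π† = Π̂ ×_Ẑ ℤ`: "`Π†` fails to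
satisfy various fundamental absolute anabelian properties". ([IUTchIII] Rmk 2.1.2 (ii) p.65 l.1–5)
[claim: Mochizuki2012, status: disputed] -/
theorem not_piTempNormallyTerminal_curveχ : ¬ (curveχ p).PiTempNormallyTerminal := by
  change ¬ (Subgroup.normalizer (((toHatχ p).toMonoidHom.range : Subgroup (PiHtχ p)) : Set (PiHtχ p)) =
    (toHatχ p).toMonoidHom.range)
  rw [normalizer_range_toHatχ_eq_top p]
  exact fun h => range_toHatχ_ne_top p h.symm

end Arith

/-! ### The class certificate: NO `Ẑ`-preimage of a proper subgroup is normally terminal -/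

/-- **Certificate for the whole class of "partially tempered" models** (input BY NAME for the abc-iut-L6
«MODEL-NT AUDIT»): for ANY group `Π̂`, any surjection `f : Π̂ ↠ A` onto an abelian group and any PROPER subgroup
`Z ⊊ A`, the preimage `Π† := f⁻¹(Z)` satisfies `N_{Π̂}(Π†) = Π̂ ≠ Π†` — so no such `Π†` can serve as the image of a
normally terminal tempered group (typed [SemiAnbd] Lem. 6.1 (iii)), exactly as [IUTchIII] Rmk. 2.1.2 (ii)
answers "no". ([IUTchIII] Rmk 2.1.2 (ii) p.64 l.22 – p.65 l.5) [claim: Mochizuki2012, status: disputed] -/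
theorem normalizer_comap_ne_of_surjective_of_ne_top {PiHat : Type*} [Group PiHat] {A : Type*} [CommGroup A]
    (f : PiHat →* A) (hf : Surjective f) {Z : Subgroup A} (hZ : Z ≠ ⊤) :
    Subgroup.normalizer ((Z.comap f : Subgroup PiHat) : Set PiHat) = ⊤ ∧ Z.comap f ≠ ⊤ := by
  refine ⟨Subgroup.normalizer_eq_top _, fun h => hZ ?_⟩
  rw [eq_top_iff]
  intro a _
  obtain ⟨x, rfl⟩ := hf a
  have hx : x ∈ Z.comap f := h ▸ Subgroup.mem_top x
  exact hx

end Literature.IUT.LogThetaLattice.MultiradialityRemarks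

end
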